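import Summits.BirchSwinnertonDyer.BirchSwinnertonDyer.Theorems.SylvesterTwoHeegnerIndexCMFlipLevelPairPrep
import HarnessLib

/-!
# (H-d1) of leaf (L1), crux `UpperOffV0HSYPlus` (stmt-BirchSwinnertonDyer-19804): two small lemmas of the assembly —
# the smallest prime factor of `ℓℓ'`, and COMMUTING KOLYVAGIN DERIVATIVES

`minFac_mul_of_lt` (the canonical orientation `(minFac n, n / minFac n)` of a product of two primes) and
`derivOp_derivOp_comm` (`D_{σ,ℓ} D_{σ',ℓ'} = D_{σ',ℓ'} D_{σ,ℓ}` for commuting `σ, σ'`; Gross's `D_n = ∏ D_ℓ` in the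
commutative `ℤ[G_n]`), used by the assembly #H-d2 to read `c_B(ℓℓ')` in either order of the pair.  Theorems only.
-/

set_option linter.dupNamespace false
set_option autoImplicit false

noncomputable section

open scoped Classical Pointwise

namespace Summit.BirchSwinnertonDyer.BirchSwinnertonDyer.Theorems.SylvesterTwoCMFlip

open WeierstrassCurve Field NumberField IsDedekindDomain Finset
open Literature.NumberTheory.EllipticCurves Literature.NumberTheory.GaloisRepresentations
  Literature.NumberTheory.EllipticCurves.ModularForms
  Literature.NumberTheory.EllipticCurves.HuShuYin2019
  Literature.NumberTheory.EllipticCurves.KolyvaginCocycle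
  Literature.NumberTheory.EllipticCurves.RingClassField
  Summit.BirchSwinnertonDyer.BirchSwinnertonDyer.Theorems.SylvesterTwoCMData
  Summit.BirchSwinnertonDyer.Rank1Residual.X11b Summit.BirchSwinnertonDyer.Rank1Residual.X11b.RingClassTower

variable {K : Type} [Field K] [NumberField K]

/-- The smallest prime factor of a product of two distinct primes, and the cofactor. [folklore] -/
theorem minFac_mul_of_lt {a b : ℕ} (ha : a.Prime) (hb : b.Prime) (hab : a < b) :
    (a * b).minFac = a ∧ a * b / (a * b).minFac = b := by
  have h1 : (a * b).minFac = a := by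
    apply le_antisymm (Nat.minFac_le_of_dvd ha.two_le (dvd_mul_right a b))
    have hmf : (a * b).minFac.Prime := Nat.minFac_prime (by nlinarith [ha.two_le, hb.two_le])
    rcases (Nat.Prime.dvd_mul hmf).mp (Nat.minFac_dvd (a * b)) with h | h
    · rw [(Nat.prime_dvd_prime_iff_eq hmf ha).mp h]
    · rw [(Nat.prime_dvd_prime_iff_eq hmf hb).mp h]; exact hab.le
  exact ⟨h1, by rw [h1, Nat.mul_div_cancel_left _ ha.pos]⟩

/-- **Two commuting automorphisms have commuting Kolyvagin derivatives**: `D_{σ,ℓ} D_{σ',ℓ'} z = D_{σ',ℓ'} D_{σ,ℓ} z`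
(`D_{σ',ℓ'}` is additive and commutes with every `σ^i`, #F2a `pointGalHom_derivOp_comm`; Gross: `D_n = ∏ D_ℓ` in the
commutative `ℤ[G_n]`). [cite: GrossLMS1991, §3 (3.6)–(3.7): D_n = ∏ D_ℓ in ℤ[G_n]] -/
theorem derivOp_derivOp_comm (W : WeierstrassCurve ℚ) {L : Type} [Field L] [CharZero L] [DecidableEq L]
    {σ σ' : L ≃ₐ[ℚ] L} (hc : Commute σ σ') (ℓ ℓ' : ℕ) (z : (W.baseChange L).toAffine.Point) :
    KolyvaginOperator.derivOp (pointGalHom W L) σ ℓ (KolyvaginOperator.derivOp (pointGalHom W L) σ' ℓ' z) =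
      KolyvaginOperator.derivOp (pointGalHom W L) σ' ℓ' (KolyvaginOperator.derivOp (pointGalHom W L) σ ℓ z) := by
  have hadd : ∀ a b : (W.baseChange L).toAffine.Point,
      KolyvaginOperator.derivOp (pointGalHom W L) σ' ℓ' (a + b) =
        KolyvaginOperator.derivOp (pointGalHom W L) σ' ℓ' a + KolyvaginOperator.derivOp (pointGalHom W L) σ' ℓ' b := by
    intro a b
    unfold KolyvaginOperator.derivOp
    rw [← Finset.sum_add_distrib]
    exact Finset.sum_congr rfl fun k _ ↦ by rw [map_add, smul_add]
  have hzero : KolyvaginOperator.derivOp (pointGalHom W L) σ' ℓ' 0 = 0 := by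
    unfold KolyvaginOperator.derivOp
    exact Finset.sum_eq_zero fun k _ ↦ by rw [map_zero, smul_zero]
  have hsum : ∀ (s : Finset ℕ) (f : ℕ → (W.baseChange L).toAffine.Point),
      KolyvaginOperator.derivOp (pointGalHom W L) σ' ℓ' (∑ i ∈ s, f i) =
        ∑ i ∈ s, KolyvaginOperator.derivOp (pointGalHom W L) σ' ℓ' (f i) := by
    intro s f
    induction s using Finset.induction_on with
    | empty => rw [Finset.sum_empty, Finset.sum_empty, hzero]
    | insert _ _ ha ih => rw [Finset.sum_insert ha, Finset.sum_insert ha, hadd, ih]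
  have hnsmul : ∀ (n : ℕ) (a : (W.baseChange L).toAffine.Point),
      KolyvaginOperator.derivOp (pointGalHom W L) σ' ℓ' (n • a) = n • KolyvaginOperator.derivOp (pointGalHom W L) σ' ℓ' a := by
    intro n a
    induction n with
    | zero => rw [zero_smul, zero_smul, hzero]
    | succ n ih => rw [succ_nsmul, succ_nsmul, hadd, ih]
  change (∑ i ∈ Finset.range (ℓ + 1), i • pointGalHom W L (σ ^ i)
      (KolyvaginOperator.derivOp (pointGalHom W L) σ' ℓ' z)) =
    KolyvaginOperator.derivOp (pointGalHom W L) σ' ℓ'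
      (∑ i ∈ Finset.range (ℓ + 1), i • pointGalHom W L (σ ^ i) z)
  rw [hsum]
  refine Finset.sum_congr rfl fun i _ ↦ ?_
  rw [hnsmul, pointGalHom_derivOp_comm W (hc.pow_left i) ℓ' z]

end Summit.BirchSwinnertonDyer.BirchSwinnertonDyer.Theorems.SylvesterTwoCMFlip

end
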